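import Mathlib
import HarnessLib
import Summits.HubbardSuperconductivity.HubbardSuperconductivity.Theorems.KLProgrammeKLRegimeSplitTwoLegIncrementSizesFromPosition

/-!
# Route `KLProgramme` — gen-5 ENGINE child 19918, stub `stub_twoLeg_step`: the ORDER-0 size of `ℓ_{n+1}(K.eval)` is the ANGULAR MEAN of the increment
# profile plus a SLOPE term — the `|U|`-order content of (E3a) `j = 0` is exactly the tadpole mean

Cell `gate-hubbard-kl`, seat p1b (g6); input to plan g12's (E4-a) question for gen 6 («is the scale-n two-leg piece really O(U²) for n ≥ 1 once the tadpole
constant is μ-absorbed?», l.1745).  k3c3-p3's order-resolved tier-1 bound (p488152) takes `G₀ = 2m₀` at `j = 0`; but k3c3-p1's `H_f` calculus needs at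
`j = 0` only `sup|δ − mean δ|`, which the SLOPE controls (`|g − mean g| ≤ 2π·sup|g′|`, p488152's `abs_sub_klAngularMean_le_of_deriv`).  Hence
**`twoLegPieceV13_size_zero_le_mean_add_slope`**: `|onM ℓ_{n+1}(K.eval)(q)| ≤ |mean δ_{n+1}| + 2X·(2π·m₁·klCurveD1)` — the only place the zeroth moment
`m₀` (which carries the momentum-INDEPENDENT single-scale tadpole, `O(|U|)`) enters is the angular mean `mean δ_{n+1}` of the increment profile; the rest is
`O(m₁) = O(U²·rate)`.  So (E3a) `j = 0` at `U²`-order for `n ≥ 1` is deliverable iff the mean of the increment profile is `O(U²)·rate` — precisely what a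
scale-by-scale δμ-flow absorbing the `klAngularMean` constant piece (k3c3-p1's row) arranges.  Position form: `m₁ = 2Mˢ₁(ΔW)` (p486520).
Proof only; nothing about the model is asserted.  References: BGM 2006 (2.36), §2.3 (tadpole / chemical-potential counterterm) [cite: BenfattoGiulianiMastropietro2006].
-/

noncomputable section

namespace Summit.HubbardSuperconductivity.HubbardSuperconductivity.Theorems.KLRegimeSplit

set_option linter.dupNamespace false -- summit = problem name (single-conjunct summit), D-0017

open Real Finset
open Literature.MathematicalPhysics.QuantumLattice Literature.Probability.LatticeModels
open Summit.HubbardSuperconductivity.HubbardSuperconductivity.Theorems.KLProgrammeLegKernels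
open Summit.HubbardSuperconductivity.HubbardSuperconductivity.Theorems.PerturbedFermiCurve
open Summit.HubbardSuperconductivity.HubbardSuperconductivity.Theorems.TwoLegFourier
open Summit.HubbardSuperconductivity.HubbardSuperconductivity.Theorems.DispersionFlow

variable {L M : ℕ} [NeZero L] [NeZero M]

/-- **Order-0 size of `ℓ_{n+1}(K.eval)` = |angular mean of the increment profile| + a slope term.**  In the explicit regime, with the increment
coefficient moments `m 0 … m 4` (only `m 1` is used in the slope term) and the cutoff numeral `X ≥ sup|χ₂|`:
`‖D⁰ onM ℓ_{n+1}(K.eval)(q)‖ ≤ |klAngularMean δ_{n+1}| + 2X·(2π·m₁·klCurveD1)`, `δ_{n+1} = ν_{n+1}(K) − ν_n(K)`. -/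
theorem twoLegPieceV13_size_zero_le_mean_add_slope {R : RenConsts} (hR : ∀ j, 0 ≤ R.Gfr j) {c : ℝ} (hc : 0 < c) (hcle : c ≤ klCurveC3 R)
    {U : ℝ} (hU : 0 < U) (hUle : U ≤ klCurveU0 R) {β : ℝ} (hβmin : klBetaMin ≤ β) (hβc : β ≤ Real.exp (c / U ^ 2))
    {μ : ℝ} (hμ : μ ∈ klWindowC) {K : TrigPolyC4v} (hK : FrameOK R U (nScales β) μ K) (n : ℕ) {m : ℕ → ℝ}
    (hm : ∀ k ≤ 4, ∑ x : TorusSite 2 L, (1 + (x 0).valMinAbs.natAbs + (x 1).valMinAbs.natAbs : ℝ) ^ k *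
      |torusCosCoeff L (fun k => klLocSelfEnergyRe L M β U μ K (n + 1) k - klLocSelfEnergyRe L M β U μ K n k) x| ≤ m k)
    {X : ℝ} (hX : ∀ x : ℝ, ‖iteratedFDeriv ℝ 0 salmhoferCutoff x‖ ≤ X) (q : Momentum) :
    ‖iteratedFDeriv ℝ 0 (onM (klTwoLegPieceFn L M β U μ K.eval (n + 1))) q‖ ≤
      |klAngularMean (fun θ => klLocalPart L M β U μ K (n + 1) θ - klLocalPart L M β U μ K n θ)| +
        2 * X * (2 * π * (m 1 * klCurveD1)) := by
  obtain ⟨hAf, hA20, hADt, -, ⟨hlo, hhi⟩, hA3f, hA4f⟩ := frame_sizes_of_frameOK_explicit hR hc hcle hU hUle hβmin hβc hμ hK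
  have H := fun θ => increment_angular_sizes_explicit (L := L) (M := M) hR hc hcle hU hUle hβmin hβc hμ hK hA3f hA4f β n (n + 1) hm θ
  set g := fun θ => klLocalPart L M β U μ K (n + 1) θ - klLocalPart L M β U μ K n θ with hg
  have hC : ContDiff ℝ 4 g := (H 0).1
  have hdiff : Differentiable ℝ g := hC.differentiable (by norm_num)
  have hper : Function.Periodic g (2 * π) := fun θ => by
    simp only [hg, klLocalPart_periodic β U μ K (n + 1) θ, klLocalPart_periodic β U μ K n θ]
  have h1 : ∀ θ, |deriv g θ| ≤ m 1 * klCurveD1 := fun θ => by rw [← iteratedDeriv_one]; exact (H θ).2.2.1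
  have hosc : ∀ t, |g t - klAngularMean g| ≤ 2 * π * (m 1 * klCurveD1) := fun t => abs_sub_klAngularMean_le_of_deriv hdiff hper h1 t
  have hνC : ∀ k : ℕ, ContDiff ℝ 4 (klLocalPart L M β U μ K k) := fun k =>
    contDiff_klLocalPart _ hAf hADt hlo hhi L M β U k
  have hG : ∀ i ≤ 0, ∀ t : ℝ, ‖iteratedFDeriv ℝ i (fun t => g t - klAngularMean g) t‖ ≤ 2 * π * (m 1 * klCurveD1) := by
    intro i hi t
    obtain rfl : i = 0 := Nat.le_zero.1 hi
    rw [norm_iteratedFDeriv_zero, Real.norm_eq_abs]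
    exact hosc t
  have hX' : ∀ l ≤ 0, ∀ x : ℝ, ‖iteratedFDeriv ℝ l salmhoferCutoff x‖ ≤ X := fun l hl x => by
    obtain rfl : l = 0 := Nat.le_zero.1 hl
    exact hX x
  have hmain := norm_iteratedFDeriv_onM_klTwoLegPieceFn_eval_succ_le (L := L) (M := M) K n (N := 4) (hνC (n + 1)) (hνC n)
    (j := 0) (by norm_num) hμ hG hX' q
  refine hmain.trans (le_of_eq ?_)
  simp [hg]

/-- **Position form**: the slope term read from the first pinned spatial moment `Mˢ₁` of the increment kernel (`m 1 = 2Mˢ₁`):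
`‖D⁰ onM ℓ_{n+1}(K.eval)(q)‖ ≤ |mean δ_{n+1}| + 2X·(2π·(2Mˢ₁)·klCurveD1)`. -/
theorem twoLegPieceV13_size_zero_le_mean_add_slope_of_position {R : RenConsts} (hR : ∀ j, 0 ≤ R.Gfr j) {c : ℝ} (hc : 0 < c)
    (hcle : c ≤ klCurveC3 R) {U : ℝ} (hU : 0 < U) (hUle : U ≤ klCurveU0 R) {β : ℝ} (hβmin : klBetaMin ≤ β)
    (hβc : β ≤ Real.exp (c / U ^ 2)) {μ : ℝ} (hμ : μ ∈ klWindowC) {K : TrigPolyC4v} (hK : FrameOK R U (nScales β) μ K) (n : ℕ)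
    {Ms : ℕ → ℝ}
    (hMs : ∀ k ≤ 4, ∀ (σ : Fin 2) (x₀ : SpaceTimeIdx L M), imagTimeWeight β M *
      ∑ x ∈ (univ : Finset (Fin 2 → SpaceTimeIdx L M)).filter (fun x => x 0 = x₀),
        (1 + ((((x 1).2 - (x 0).2) 0).valMinAbs.natAbs : ℝ) + ((((x 1).2 - (x 0).2) 1).valMinAbs.natAbs : ℝ)) ^ k *
          ‖sectorisedKernel L M β (trivialMultiplier L M) (klEffectiveAction L M β U μ K klE0 (n + 1)) 2
              (![((0, σ), 0), ((0, σ), 1)] : Fin 2 → SectorLeg 1) x -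
            sectorisedKernel L M β (trivialMultiplier L M) (klEffectiveAction L M β U μ K klE0 n) 2
              (![((0, σ), 0), ((0, σ), 1)] : Fin 2 → SectorLeg 1) x‖ ≤ Ms k)
    {X : ℝ} (hX : ∀ x : ℝ, ‖iteratedFDeriv ℝ 0 salmhoferCutoff x‖ ≤ X) (q : Momentum) :
    ‖iteratedFDeriv ℝ 0 (onM (klTwoLegPieceFn L M β U μ K.eval (n + 1))) q‖ ≤
      |klAngularMean (fun θ => klLocalPart L M β U μ K (n + 1) θ - klLocalPart L M β U μ K n θ)| +
        2 * X * (2 * π * (2 * Ms 1 * klCurveD1)) := by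
  have hβ : 0 < β := lt_of_lt_of_le (by unfold klBetaMin; norm_num) hβmin
  exact twoLegPieceV13_size_zero_le_mean_add_slope (L := L) (M := M) hR hc hcle hU hUle hβmin hβc hμ hK n (m := fun k => 2 * Ms k)
    (fun k hk => sum_weight_abs_torusCosCoeff_klLocSelfEnergyRe_sub_le hβ U μ K n k (hMs k hk)) hX q

end Summit.HubbardSuperconductivity.HubbardSuperconductivity.Theorems.KLRegimeSplit

end
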